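import Literature.NumberTheory.Automorphic.UnitaryGroupTorusOrbitalIntegralCanonical   -- ★ S0 FILE 2 (F0P3b-p01 (g7)): the `cmDatumLocalCongr`-frame version and its whole ★ chain
import HarnessLib

/-!
# The CANONICAL orbital integral of `U(H)(L⁺_v)` at a regular split-torus class in Iwasawa coordinates — ARBITRARY FRAME
(Rogawski (1990), §4.9 pp. 54–56, §4.13 p. 70 «`dg = dk dm du`», §4.3 (4.3.1) p. 43; Deitmar–Echterhoff (2014) Thm. 1.5.3)

Topic `NumberTheory/Automorphic`; namespace `Literature.NumberTheory.Automorphic.UnitaryGroup`.  KERNEL mathematics only: one theorem, no definition,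
no named fact, no instance, no `sorry`.  Cell `pub/hodgecm-mathlib`, road «S3-tree», T3′ «DEPTH-ZERO κ-TRANSFER» population P-3 «LEVI» (organ L-γ needs the
torus descent through a LEVEL-PRESERVING frame `Ψ(K′) = K₃`, which the `cmDatumLocalCongr` frame of ★ S0 FILE 2 does not assert); seat F0P3a-p04 (g16).
HONEST LABEL: HC_CM is proved only modulo the 2 remaining named inputs (hLiu418, h413) until rung 0 closes; this file discharges no named fact.

`classOrbitalIntegral_eq_smul_integral_prod_of_torus_regular_of_frame` = ★ `classOrbitalIntegral_eq_smul_integral_prod_of_torus_regular` with the frame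
generalised to any `Ψ : U(H)(L⁺_v) ≃ₜ* U(Φ₃)(L⁺_v)` with `g ∼ Ψ g` in `GL₃(∏_{w∣v} L_w)` and the class point any `γ₀` with `Ψ γ₀ = t`; the proof is the ★ proof
verbatim from its second step on (adapted from `UnitaryGroupTorusOrbitalIntegralCanonical.lean`, F0P3b-p01 (g7)).

## References
* [Rogawski1990] J. D. Rogawski, *Automorphic Representations of Unitary Groups in Three Variables*, Ann. of Math. Stud. 123 (1990), §4.9 pp. 54–56
  (Prop. 4.9.1, Lemma 4.9.2); §4.13 Lemma 4.13.1 (a) p. 64, proof p. 70; §4.3 (4.3.1) p. 43.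
* [DeitmarEchterhoff2014] A. Deitmar, S. Echterhoff, *Principles of Harmonic Analysis*, 2nd ed. (2014), Thm. 1.5.3.
-/

set_option autoImplicit false

noncomputable section

open MeasureTheory Measure Set Filter Topology NumberField IsDedekindDomain
open Literature.MeasureTheory.Group
open scoped ENNReal NNReal Matrix MatrixGroups

namespace Literature.NumberTheory.Automorphic.UnitaryGroup

open Literature.NumberTheory.Rogawski1990 (IsRegularElt isRegularElt_iff isRegularElt_of_isConj)
open Literature.NumberTheory.Automorphic

set_option maxHeartbeats 1600000 in
-- instance-term unification on the CM local carriers (as in ★ g6 `exists_classOrbitalIntegral_indicator_eq_twist_of_torus_regular_of_nonsplit`)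
/-- **THE CANONICAL ORBITAL INTEGRAL OF THE INNER FORM AT A REGULAR SPLIT-TORUS CLASS — ANY FRAME.**  ★ `classOrbitalIntegral_eq_smul_integral_prod_of_torus_regular`
(S0 FILE 2) with the frame `e = cmDatumLocalCongr L v T ha h` replaced by an ARBITRARY continuous multiplicative equivalence `Ψ : U(H)(L⁺_v) ≃ₜ* U(Φ₃)(L⁺_v)` whose
values are `GL₃(∏ L_w)`-conjugate to their arguments (`hΨc`; e.g. the LEVEL-PRESERVING Jacobowitz frame ★ `exists_continuousMulEquiv_level_formCongr_of_nonsplit`):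
for `γ₀ ∈ U(H)(L⁺_v)` with `Ψ γ₀ = t` a REGULAR diagonal `t = diag(d) ∈ T(L⁺_v)`, ANY Haar `νG`, a CANONICAL family `mG`, the hyperspecial `K = K₃` (`hKv`),
Haar `κ`, `μ_N` and every Borel `φ`:
**`classOrbitalIntegral mG φ ⟦γ₀⟧ = ((νG(Ψ⁻¹ K) ∕ (κ(K) · μ_N(N ∩ K))) · J₃(t)).toReal • ∫_{K × N} φ(Ψ⁻¹(k (t n) k⁻¹)) d(κ ⊗ μ_N)`**.
The proof is the ★ one VERBATIM after its first step (which only used `e t = T t T⁻¹` to get the conjugacy now supplied by `hΨc`) — adapted from ★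
`UnitaryGroupTorusOrbitalIntegralCanonical` (F0P3b-p01 (g7)).
[cite: Rogawski1990, §4.9 pp. 54–56; §4.13 Lemma 4.13.1 (a) p. 64 and p. 70; §4.3 (4.3.1) p. 43] [cite: DeitmarEchterhoff2014, Thm. 1.5.3] -/
theorem classOrbitalIntegral_eq_smul_integral_prod_of_torus_regular_of_frame
    (L : Type) [Field L] [NumberField L] [IsCMField L] (H : Matrix (Fin 3) (Fin 3) L)
    (hH : (H.map (IsCMField.complexConj L))ᵀ = H) (hHd : IsUnit H.det)
    {v : HeightOneSpectrum (𝓞 ↥(maximalRealSubfield L))} (w : PlacesOver L v) (hw : IsCMField.complexConj L • w.1 = w.1)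
    [MeasurableSpace ((cmDatum L 3 H).Local v)] [BorelSpace ((cmDatum L 3 H).Local v)]
    [∀ γ : (cmDatum L 3 H).Local v, MeasurableSpace (((cmDatum L 3 H).Local v) ⧸ Subgroup.centralizer ({γ} : Set ((cmDatum L 3 H).Local v)))]
    [∀ γ : (cmDatum L 3 H).Local v, BorelSpace (((cmDatum L 3 H).Local v) ⧸ Subgroup.centralizer ({γ} : Set ((cmDatum L 3 H).Local v)))]
    (νG : Measure ((cmDatum L 3 H).Local v)) [νG.IsHaarMeasure] [νG.IsMulRightInvariant]
    {mG : OrbitalMeasureFamily ((cmDatum L 3 H).Local v)}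
    (hmG : mG.IsCanonical (fun γ => IsRegularElt (γ.val : GL (Fin 3) (LocalRing L v))) νG)
    [MeasurableSpace ↥(unitaryGroupOfForm (conjLocal L (IsCMField.complexConj L) v) (cmLocalForm L 3 v))]
    [BorelSpace ↥(unitaryGroupOfForm (conjLocal L (IsCMField.complexConj L) v) (cmLocalForm L 3 v))]
    (Ψ : (cmDatum L 3 H).Local v ≃ₜ* ↥(unitaryGroupOfForm (conjLocal L (IsCMField.complexConj L) v) (cmLocalForm L 3 v)))
    (hΨc : ∀ g : (cmDatum L 3 H).Local v, IsConj (g.val : GL (Fin 3) (LocalRing L v))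
      ((Ψ g : ↥(unitaryGroupOfForm (conjLocal L (IsCMField.complexConj L) v) (cmLocalForm L 3 v))) : GL (Fin 3) (LocalRing L v)))
    {K : Subgroup ↥(unitaryGroupOfForm (conjLocal L (IsCMField.complexConj L) v) (cmLocalForm L 3 v))}
    (hKv : ∀ g : ↥(unitaryGroupOfForm (conjLocal L (IsCMField.complexConj L) v) (cmLocalForm L 3 v)),
      g ∈ K ↔ g ∈ cmLocalIntegralLevel L 3 (Matrix.of fun i j : Fin 3 => if i.val + j.val + 1 = 3 then (1 : L) else 0) v)
    (κ : Measure ↥K) [κ.IsHaarMeasure]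
    (μN : Measure ↥(unipotentU (conjLocal L (IsCMField.complexConj L) v) (cmLocalForm L 3 v))) [μN.IsHaarMeasure]
    (t : ↥(torusU (conjLocal L (IsCMField.complexConj L) v) (cmLocalForm L 3 v))) {d : Fin 3 → (LocalRing L v)ˣ}
    (hd : glDiagonal 3 (LocalRing L v) d =
      ((t : ↥(unitaryGroupOfForm (conjLocal L (IsCMField.complexConj L) v) (cmLocalForm L 3 v))) : GL (Fin 3) (LocalRing L v)))
    (hreg : ∀ i j, i ≠ j → IsUnit ((d i : LocalRing L v) - d j))
    (ha' : IsUnit ((((d 0)⁻¹ * d 1 : (LocalRing L v)ˣ) : LocalRing L v) - 1))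
    (hb' : IsUnit ((((d 0)⁻¹ * d 2 : (LocalRing L v)ˣ) : LocalRing L v) - 1))
    {γ₀ : (cmDatum L 3 H).Local v} (hγ₀ : Ψ γ₀ = (t : ↥(unitaryGroupOfForm (conjLocal L (IsCMField.complexConj L) v) (cmLocalForm L 3 v))))
    {φ : (cmDatum L 3 H).Local v → ℂ} (hφ : Measurable φ) :
    classOrbitalIntegral mG φ (ConjClasses.mk γ₀) =
      ((νG (Ψ ⁻¹' (K : Set ↥(unitaryGroupOfForm (conjLocal L (IsCMField.complexConj L) v) (cmLocalForm L 3 v))))) /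
            (κ univ * μN {n | (n : ↥(unitaryGroupOfForm (conjLocal L (IsCMField.complexConj L) v) (cmLocalForm L 3 v))) ∈ K}) *
          ((letI : MeasurableSpace (LocalRing L v) := borel _; haveI : BorelSpace (LocalRing L v) := ⟨rfl⟩
          haveI : SecondCountableTopology (LocalRing L v) := secondCountableTopology_localRing (E := L) v
          ((distribHaarChar (LocalRing L v) ha'.unit)⁻¹ *
            (HeisRing.skewModulus (conjLocal L (IsCMField.complexConj L) v) (continuous_conjLocal L (IsCMField.complexConj L) v) hb'.unit
              (HeisRing.map_unit_torusCentralScalar_sub_one (conjLocal L (IsCMField.complexConj L) v) (cmLocalForm_eq_over L 3 v) t hd hb'))⁻¹ :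
                ℝ≥0)) : ℝ≥0∞)).toReal •
        ∫ p : ↥K × ↥(unipotentU (conjLocal L (IsCMField.complexConj L) v) (cmLocalForm L 3 v)),
          φ (Ψ.symm
            ((p.1 : ↥(unitaryGroupOfForm (conjLocal L (IsCMField.complexConj L) v) (cmLocalForm L 3 v))) * ((t : ↥(unitaryGroupOfForm (conjLocal L (IsCMField.complexConj L) v) (cmLocalForm L 3 v))) * (p.2 : ↥(unitaryGroupOfForm (conjLocal L (IsCMField.complexConj L) v) (cmLocalForm L 3 v)))) * (p.1 : ↥(unitaryGroupOfForm (conjLocal L (IsCMField.complexConj L) v) (cmLocalForm L 3 v)))⁻¹)) ∂(κ.prod μN) := by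
  have hc := IsCMField.complexConj_ne_one L
  haveI : Algebra.IsQuadraticExtension ↥(maximalRealSubfield L) L := IsCMField.isQuadraticExtension L
  -- Step 1: the frame `Ψ` (any continuous multiplicative equivalence inducing `GL₃`-conjugacy), the point `γ₀ = Ψ⁻¹ t` and its regularity
  set t' : ↥(unitaryGroupOfForm (conjLocal L (IsCMField.complexConj L) v) (cmLocalForm L 3 v)) := (t : ↥(unitaryGroupOfForm (conjLocal L (IsCMField.complexConj L) v) (cmLocalForm L 3 v))) with ht'
  have hψγ : Ψ γ₀ = t' := hγ₀
  have hψγ' : Ψ.toMulEquiv γ₀ = t' := hγ₀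
  -- regularity of `t` (pairwise distinct diagonal entries over the field `∏_{w ∣ v} L_w = L_w`)
  have htreg : IsRegularElt (t' : GL (Fin 3) (LocalRing L v)) := by
    letI : Field (LocalRing L v) :=
      (LocalRing.isField_of_smul_eq (IsCMField.complexConj L) hc w hw).toField
    rw [isRegularElt_iff, ht', ← hd, coe_glDiagonal, Matrix.charpoly_diagonal]
    refine Polynomial.separable_prod_X_sub_C_iff.2 fun i j hij => ?_
    by_contra hne
    have hu := hreg i j hne
    rw [hij, sub_self] at hu
    exact not_isUnit_zero hu
  have hconj : IsConj (t' : GL (Fin 3) (LocalRing L v)) (γ₀.val : GL (Fin 3) (LocalRing L v)) := by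
    have h1 := hΨc γ₀
    rw [hψγ] at h1
    exact h1.symm
  have hreg₀ : IsRegularElt (γ₀.val : GL (Fin 3) (LocalRing L v)) := isRegularElt_of_isConj hconj htreg
  -- Step 2: the canonical measure at `γ₀`; the class orbital integral at the representative `γ₀`
  letI : MeasurableSpace («local» L (IsCMField.complexConj L) 3 H v) := ‹MeasurableSpace ((cmDatum L 3 H).Local v)›
  haveI : BorelSpace («local» L (IsCMField.complexConj L) 3 H v) := ‹BorelSpace ((cmDatum L 3 H).Local v)›
  obtain ⟨tZ, htZ, htZi, htZ1⟩ : ∃ tz : Measure ↥(Subgroup.centralizer ({γ₀} : Set ((cmDatum L 3 H).Local v))),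
      tz.IsHaarMeasure ∧ tz.IsInvInvariant ∧ tz (compactCore (↥(Subgroup.centralizer ({γ₀} : Set ((cmDatum L 3 H).Local v))))) = 1 :=
    forall_isRegularElt_exists_isHaarMeasure_compactCore_centralizer_local_eq_one (IsCMField.complexConj L) 3 H hc hH hHd γ₀ hreg₀
  haveI := htZ
  haveI := htZi
  have hP : ∀ g x : (cmDatum L 3 H).Local v, IsRegularElt (g.val : GL (Fin 3) (LocalRing L v)) →
      IsRegularElt ((x * g * x⁻¹).val : GL (Fin 3) (LocalRing L v)) := fun g x hg =>
    (Literature.NumberTheory.Rogawski1990.isRegularElt_conj_iff (x.val : GL (Fin 3) (LocalRing L v)) (g.val : GL (Fin 3) (LocalRing L v))).2 hg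
  rw [hmG.classOrbitalIntegral_mk_eq_orbitalIntegral' hP hreg₀ tZ htZ1]
  -- Step 3: structure on `G₃ = U(Φ₃)(L⁺_v)` and the transported measures
  haveI : LocallyCompactSpace ↥(unitaryGroupOfForm (conjLocal L (IsCMField.complexConj L) v) (cmLocalForm L 3 v)) := locallyCompactSpace_local (IsCMField.complexConj L) 3 _ v
  haveI : SecondCountableTopology ↥(unitaryGroupOfForm (conjLocal L (IsCMField.complexConj L) v) (cmLocalForm L 3 v)) := secondCountableTopology_local (IsCMField.complexConj L) 3 _ v
  letI mQ : MeasurableSpace (↥(unitaryGroupOfForm (conjLocal L (IsCMField.complexConj L) v) (cmLocalForm L 3 v)) ⧸ torusU (conjLocal L (IsCMField.complexConj L) v) (cmLocalForm L 3 v)) := borel _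
  haveI : BorelSpace (↥(unitaryGroupOfForm (conjLocal L (IsCMField.complexConj L) v) (cmLocalForm L 3 v)) ⧸ torusU (conjLocal L (IsCMField.complexConj L) v) (cmLocalForm L 3 v)) := ⟨rfl⟩
  -- `Ψ Z(γ₀) = T` for `Ψ := e.symm`
  have hZT : ∀ g : (cmDatum L 3 H).Local v, Ψ.toMulEquiv g ∈ torusU (conjLocal L (IsCMField.complexConj L) v) (cmLocalForm L 3 v) ↔
      g ∈ Subgroup.centralizer ({γ₀} : Set ((cmDatum L 3 H).Local v)) := by
    intro g
    rw [mem_torusU_iff_mem_centralizer_of_isUnit_sub hd hreg, Subgroup.mem_centralizer_singleton_iff,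
      Subgroup.mem_centralizer_singleton_iff, ← hψγ]
    change Ψ g * Ψ γ₀ = Ψ γ₀ * Ψ g ↔ g * γ₀ = γ₀ * g
    rw [← map_mul, ← map_mul, Ψ.injective.eq_iff]
  -- the transported Haar measures
  obtain ⟨ν, hν⟩ : ∃ ν : Measure ↥(unitaryGroupOfForm (conjLocal L (IsCMField.complexConj L) v) (cmLocalForm L 3 v)), ν = Measure.map Ψ.toMulEquiv νG := ⟨_, rfl⟩
  haveI : ν.IsHaarMeasure := by
    rw [hν]; exact MulEquiv.isHaarMeasure_map νG Ψ.toMulEquiv Ψ.continuous Ψ.symm.continuous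
  haveI : ν.IsMulRightInvariant := by
    rw [hν]; exact isMulRightInvariant_map_mulEquiv_of_isMulRightInvariant Ψ.toMulEquiv Ψ.continuous.measurable νG
  haveI hZc : IsClosed ((Subgroup.centralizer ({γ₀} : Set ((cmDatum L 3 H).Local v)) : Subgroup ((cmDatum L 3 H).Local v)) :
      Set ((cmDatum L 3 H).Local v)) := isClosed_coe_centralizer_singleton γ₀
  have hT : IsClosed ((torusU (conjLocal L (IsCMField.complexConj L) v) (cmLocalForm L 3 v) : Subgroup ↥(unitaryGroupOfForm (conjLocal L (IsCMField.complexConj L) v) (cmLocalForm L 3 v))) : Set ↥(unitaryGroupOfForm (conjLocal L (IsCMField.complexConj L) v) (cmLocalForm L 3 v))) :=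
    isClosed_cmBorelTriple_M L v
  haveI : LocallyCompactSpace ↥(Subgroup.centralizer ({γ₀} : Set ((cmDatum L 3 H).Local v))) :=
    hZc.isClosedEmbedding_subtypeVal.locallyCompactSpace
  haveI : SecondCountableTopology ↥(Subgroup.centralizer ({γ₀} : Set ((cmDatum L 3 H).Local v))) :=
    TopologicalSpace.Subtype.secondCountableTopology _
  haveI : LocallyCompactSpace ↥(torusU (conjLocal L (IsCMField.complexConj L) v) (cmLocalForm L 3 v)) :=
    hT.isClosedEmbedding_subtypeVal.locallyCompactSpace
  haveI : SecondCountableTopology ↥(torusU (conjLocal L (IsCMField.complexConj L) v) (cmLocalForm L 3 v)) :=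
    TopologicalSpace.Subtype.secondCountableTopology _
  let eH := subgroupCongrHomeomorph Ψ.toMulEquiv (Subgroup.centralizer ({γ₀} : Set ((cmDatum L 3 H).Local v)))
    (torusU (conjLocal L (IsCMField.complexConj L) v) (cmLocalForm L 3 v)) hZT Ψ.continuous Ψ.symm.continuous
  let eZ : ↥(Subgroup.centralizer ({γ₀} : Set ((cmDatum L 3 H).Local v))) ≃ₜ*
      ↥(torusU (conjLocal L (IsCMField.complexConj L) v) (cmLocalForm L 3 v)) :=
    { toMulEquiv :=
        { toEquiv := eH.toEquiv
          map_mul' := fun a b => Subtype.ext (map_mul Ψ (a : (cmDatum L 3 H).Local v) (b : (cmDatum L 3 H).Local v)) }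
      continuous_toFun := eH.continuous
      continuous_invFun := eH.symm.continuous }
  have heZ : (eZ : _ → ↥(torusU (conjLocal L (IsCMField.complexConj L) v) (cmLocalForm L 3 v))) = eH := rfl
  obtain ⟨tT, htT⟩ : ∃ tT : Measure ↥(torusU (conjLocal L (IsCMField.complexConj L) v) (cmLocalForm L 3 v)), tT = Measure.map eH tZ :=
    ⟨_, rfl⟩
  haveI : tT.IsHaarMeasure := by
    rw [htT, ← heZ]; exact MulEquiv.isHaarMeasure_map tZ eZ.toMulEquiv eZ.continuous eZ.symm.continuous
  haveI : tT.IsInvInvariant := by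
    rw [htT, ← heZ]; exact isInvInvariant_map_mulEquiv eZ.toMulEquiv eZ.continuous.measurable tZ
  -- Step 4: the level `K = K₃`, a Haar measure on `T`, and the Iwasawa form of `ν∕t_T`
  have hK3 : K = cmLocalIntegralLevel L 3 (Matrix.of fun i j : Fin 3 => if i.val + j.val + 1 = 3 then (1 : L) else 0) v :=
    Subgroup.ext hKv
  have hK3co : IsCompact (K : Set ↥(unitaryGroupOfForm (conjLocal L (IsCMField.complexConj L) v) (cmLocalForm L 3 v))) ∧ IsOpen (K : Set ↥(unitaryGroupOfForm (conjLocal L (IsCMField.complexConj L) v) (cmLocalForm L 3 v))) := by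
    rw [hK3]; exact isCompact_isOpen_cmLocalIntegralLevel L 3 (Matrix.of fun i j : Fin 3 => if i.val + j.val + 1 = 3 then (1 : L) else 0) v
  haveI : LocallyCompactSpace ↥K := hK3co.1.isClosed.isClosedEmbedding_subtypeVal.locallyCompactSpace
  haveI : LocallyCompactSpace ↥(unipotentU (conjLocal L (IsCMField.complexConj L) v) (cmLocalForm L 3 v)) :=
    (isClosed_cmBorelTriple_N L v).isClosedEmbedding_subtypeVal.locallyCompactSpace
  haveI : SecondCountableTopology ↥(unipotentU (conjLocal L (IsCMField.complexConj L) v) (cmLocalForm L 3 v)) :=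
    TopologicalSpace.Subtype.secondCountableTopology _
  obtain ⟨α, hα⟩ : ∃ α : Measure ↥(torusU (conjLocal L (IsCMField.complexConj L) v) (cmLocalForm L 3 v)), α.IsHaarMeasure :=
    ⟨Measure.haar, inferInstance⟩
  haveI : SMulInvariantMeasure ↥(unitaryGroupOfForm (conjLocal L (IsCMField.complexConj L) v) (cmLocalForm L 3 v)) (↥(unitaryGroupOfForm (conjLocal L (IsCMField.complexConj L) v) (cmLocalForm L 3 v)) ⧸ torusU (conjLocal L (IsCMField.complexConj L) v) (cmLocalForm L 3 v))
      (quotientMeasure (torusU (conjLocal L (IsCMField.complexConj L) v) (cmLocalForm L 3 v)) tT hT ν) :=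
    smulInvariantMeasure_quotientMeasure _ tT hT ν
  have hμ0 : quotientMeasure (torusU (conjLocal L (IsCMField.complexConj L) v) (cmLocalForm L 3 v)) tT hT ν ≠ 0 :=
    quotientMeasure_ne_zero _ tT hT ν
  have hKB : ∀ g : ↥(unitaryGroupOfForm (conjLocal L (IsCMField.complexConj L) v) (cmLocalForm L 3 v)), ∃ k ∈ K, ∃ b ∈ borelU (conjLocal L (IsCMField.complexConj L) v) (cmLocalForm L 3 v), g = k * b := fun g => by
    obtain ⟨k, hk, b, hb⟩ := exists_mem_cmLocalIntegralLevel_mul_borel L 3 v g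
    exact ⟨k, by rw [hK3]; exact hk, b.1, b.2, hb⟩
  obtain ⟨C, -, hμC⟩ := exists_measure_quotient_torusU_cmLocal_eq_smul_map L v hK3co.1 hKB κ α μN
    (quotientMeasure (torusU (conjLocal L (IsCMField.complexConj L) v) (cmLocalForm L 3 v)) tT hT ν) hμ0
  -- Step 5: the normalisation `t_T(T ∩ K₃) = 1` (compact core of `Z(γ₀)` read in `GL₃(L_w)`)
  -- the inner-form level transported from `K₃`: `K′ := K.comap e.symm`
  set K' : Subgroup ((cmDatum L 3 H).Local v) := K.comap Ψ.toMulEquiv.toMonoidHom with hK'def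
  have hK' : ∀ g : (cmDatum L 3 H).Local v, g ∈ K' ↔ Ψ.toMulEquiv g ∈ K := fun g => Subgroup.mem_comap
  have hψm : Measurable (Ψ.toMulEquiv : (cmDatum L 3 H).Local v → ↥(unitaryGroupOfForm (conjLocal L (IsCMField.complexConj L) v) (cmLocalForm L 3 v))) := Ψ.continuous.measurable
  have hK'c : IsCompact (K' : Set ((cmDatum L 3 H).Local v)) := by
    have hpre : (K' : Set ((cmDatum L 3 H).Local v)) = Ψ.symm '' (K : Set ↥(unitaryGroupOfForm (conjLocal L (IsCMField.complexConj L) v) (cmLocalForm L 3 v))) := by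
      ext g
      rw [SetLike.mem_coe, hK']
      constructor
      · intro hg
        exact ⟨Ψ.toMulEquiv g, hg, Ψ.symm_apply_apply g⟩
      · rintro ⟨k, hk, rfl⟩
        rw [show Ψ.toMulEquiv (Ψ.symm k) = k from Ψ.apply_symm_apply k]
        exact hk
    rw [hpre]
    exact hK3co.1.image Ψ.symm.continuous
  -- the `w`-component of `t` is the regular diagonal `diag(d_w)`
  have hγmat : (((localNonsplitEquiv (IsCMField.complexConj L) (Matrix.of fun i j : Fin 3 => if i.val + j.val + 1 = 3 then (1 : L) else 0)
        hc w hw (Ψ.toMulEquiv γ₀) : ↥(unitaryGroupOfForm (galAdicCompletionMap (L := L) (IsCMField.complexConj L) hw)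
          (placeForm (Matrix.of fun i j : Fin 3 => if i.val + j.val + 1 = 3 then (1 : L) else 0) w.1))) :
        GL (Fin 3) (w.1.adicCompletion L)) : Matrix (Fin 3) (Fin 3) (w.1.adicCompletion L)) =
      Matrix.diagonal fun i => ((d i : (LocalRing L v)ˣ) : LocalRing L v) w := by
    rw [coe_coe_localNonsplitEquiv_apply, hψγ', ← hd, coe_glDiagonal,
      Matrix.diagonal_map (RingHom.map_zero (Pi.evalRingHom (fun w' : PlacesOver L v => w'.1.adicCompletion L) w))]
    rfl
  have hdw : ∀ i j : Fin 3, i ≠ j → IsUnit (((d i : (LocalRing L v)ˣ) : LocalRing L v) w - ((d j : (LocalRing L v)ˣ) : LocalRing L v) w) := by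
    intro i j hij
    have h1 := (hreg i j hij).map (Pi.evalRingHom (fun w' : PlacesOver L v => w'.1.adicCompletion L) w)
    rwa [map_sub] at h1
  have hcore : compactCore ↥(Subgroup.centralizer ({γ₀} : Set ((cmDatum L 3 H).Local v))) ⊆
      Subtype.val ⁻¹' (K' : Set ((cmDatum L 3 H).Local v)) := by
    refine compactCore_centralizer_subset_of_hom 3 (w.1)
      ((unitaryGroupOfForm (galAdicCompletionMap (L := L) (IsCMField.complexConj L) hw)
          (placeForm (Matrix.of fun i j : Fin 3 => if i.val + j.val + 1 = 3 then (1 : L) else 0) w.1)).subtype.comp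
        ((localNonsplitEquiv (IsCMField.complexConj L) (Matrix.of fun i j : Fin 3 => if i.val + j.val + 1 = 3 then (1 : L) else 0)
          hc w hw).toMulEquiv.toMonoidHom.comp Ψ.toMulEquiv.toMonoidHom))
      (continuous_subtype_val.comp ((localNonsplitEquiv (IsCMField.complexConj L)
        (Matrix.of fun i j : Fin 3 => if i.val + j.val + 1 = 3 then (1 : L) else 0) hc w hw).continuous.comp Ψ.continuous))
      K' (fun g => ?_) γ₀ _ rfl ?_
    · exact (hK' g).trans ((hKv _).trans (mem_localIntegralLevel_iff_of_smul_eq (IsCMField.complexConj L) 3 _ hc w hw (Ψ g)))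
    · intro C' hC' hC'Z
      exact subgroup_le_glInt_of_isCompact_of_le_centralizer_diagonal 3 (w.1) hγmat hdw C' hC' hC'Z
  have htK1 : tT (Subtype.val ⁻¹' (K : Set ↥(unitaryGroupOfForm (conjLocal L (IsCMField.complexConj L) v) (cmLocalForm L 3 v)))) = 1 := by
    rw [htT, Measure.map_apply eH.continuous.measurable (hK3co.2.preimage continuous_subtype_val).measurableSet]
    have hpre : (eH : _ → ↥(torusU (conjLocal L (IsCMField.complexConj L) v) (cmLocalForm L 3 v))) ⁻¹' (Subtype.val ⁻¹' (K : Set ↥(unitaryGroupOfForm (conjLocal L (IsCMField.complexConj L) v) (cmLocalForm L 3 v)))) =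
        Subtype.val ⁻¹' (K' : Set ((cmDatum L 3 H).Local v)) := by
      ext z
      simp only [Set.mem_preimage]
      exact (hK' (z : (cmDatum L 3 H).Local v)).symm
    rw [hpre]
    exact measure_preimage_eq_one_of_compactCore_subset _ tZ htZ1 K' hK'c hcore
  -- Step 6: the twist module (★ A-p12) and the transported torus descent (★ S0 FILE 1 §3)
  have hTN : ∀ a ∈ torusU (conjLocal L (IsCMField.complexConj L) v) (cmLocalForm L 3 v),
      ∀ n ∈ unipotentU (conjLocal L (IsCMField.complexConj L) v) (cmLocalForm L 3 v),
        a * n * a⁻¹ ∈ unipotentU (conjLocal L (IsCMField.complexConj L) v) (cmLocalForm L 3 v) :=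
    fun a ha n hn => conj_mem_unipotentU_cmLocal L v ha hn
  have hKP : ∀ ⦃m u : ↥(unitaryGroupOfForm (conjLocal L (IsCMField.complexConj L) v) (cmLocalForm L 3 v))⦄, m ∈ torusU (conjLocal L (IsCMField.complexConj L) v) (cmLocalForm L 3 v) →
      u ∈ unipotentU (conjLocal L (IsCMField.complexConj L) v) (cmLocalForm L 3 v) → m * u ∈ K → m ∈ K := by
    rw [hK3]; exact mem_cmLocalIntegralLevel_of_torus_mul_unipotent L 3 v
  have ht'' : ∀ a ∈ torusU (conjLocal L (IsCMField.complexConj L) v) (cmLocalForm L 3 v),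
      a * Ψ.toMulEquiv γ₀ = Ψ.toMulEquiv γ₀ * a := by
    rw [hψγ']; exact forall_mem_torusU_cmLocal_comm L v t.2
  have hJac : ∀ Φ : ↥(unitaryGroupOfForm (conjLocal L (IsCMField.complexConj L) v) (cmLocalForm L 3 v)) → ℝ≥0∞, Measurable Φ →
      ∫⁻ n, Φ ((n : ↥(unitaryGroupOfForm (conjLocal L (IsCMField.complexConj L) v) (cmLocalForm L 3 v))) * Ψ.toMulEquiv γ₀ * (n : ↥(unitaryGroupOfForm (conjLocal L (IsCMField.complexConj L) v) (cmLocalForm L 3 v)))⁻¹) ∂μN =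
        ((letI : MeasurableSpace (LocalRing L v) := borel _; haveI : BorelSpace (LocalRing L v) := ⟨rfl⟩
          haveI : SecondCountableTopology (LocalRing L v) := secondCountableTopology_localRing (E := L) v
          ((distribHaarChar (LocalRing L v) ha'.unit)⁻¹ *
            (HeisRing.skewModulus (conjLocal L (IsCMField.complexConj L) v) (continuous_conjLocal L (IsCMField.complexConj L) v) hb'.unit
              (HeisRing.map_unit_torusCentralScalar_sub_one (conjLocal L (IsCMField.complexConj L) v) (cmLocalForm_eq_over L 3 v) t hd hb'))⁻¹ :
                ℝ≥0)) : ℝ≥0∞) * ∫⁻ n, Φ (Ψ.toMulEquiv γ₀ * (n : ↥(unitaryGroupOfForm (conjLocal L (IsCMField.complexConj L) v) (cmLocalForm L 3 v)))) ∂μN := by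
    intro Φ hΦ
    rw [hψγ']
    exact lintegral_conj_cmBorel_eq_mul_lintegral_mul L v μN t hd ha' hb' Φ hΦ
  have key := orbitalIntegral_centralizer_quotientMeasure_eq_smul_integral_of_mulEquiv (G := ↥(unitaryGroupOfForm (conjLocal L (IsCMField.complexConj L) v) (cmLocalForm L 3 v))) hK3co.2 hK3co.1 hT hTN hKP ν tT κ μN
    Ψ.toMulEquiv Ψ.continuous Ψ.symm.continuous γ₀ hZT νG hν tZ htT hμC htK1 ht'' hJac hφ
  rw [key, hψγ', hν, Measure.map_apply hψm hK3co.2.measurableSet]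
  rfl

end Literature.NumberTheory.Automorphic.UnitaryGroup

end
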